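import Literature.Analysis.FluidPDE.ElgindiTheoremTwo
import Literature.Analysis.FluidPDE.ElgindiProductLeibniz
import HarnessLib

/-!
# Linearity of the solution data and the Theorem 2 bound for differences
([Elgindi2021] §7.5 Theorem 2)

Topic `Literature/Analysis/FluidPDE`. Proof file (everything proved, no definitions, no named
facts) on the proof path of the named fact
`Literature.Analysis.FluidPDE.Elgindi.ElgindiGhoulMasmoudi2021_stabilityCore`
(`ElgindiStabilityDecomposition.lean`). T. M. Elgindi, Ann. of Math. 194 (2021) =
arXiv:1904.04795, §7.5 Theorem 2 (p. 24): the solution map `F ↦ Ψ_F` is linear, so the Theorem 2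
bound controls differences: the quantitative continuity needed to pass to limits of the data.

`SolData.sub`, `NiceDatum.sub`, `Fhat_sub`, `Gcor_sub`, `thmTwoSol_sub`, and `theoremTwo_sub`:
for nice data `F₁, F₂` with solution data of `F̂₁, F̂₂`,
`|∂_θθ((Ψ₁−Ψ₂) − (4α)⁻¹L₁₂(F₁−F₂)sin 2θ)|² + |α²D_R²(Ψ₁−Ψ₂)|² + |α²D_R(Ψ₁−Ψ₂)|² ≤ thmTwoC·|F₁−F₂|²_{𝓗⁴}`.
-/

noncomputable section

open MeasureTheory Set Function Real Filter Finset
open _root_.Topology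
open scoped ENNReal ContDiff

namespace Literature.Analysis.FluidPDE

namespace Elgindi

/-! ### Global linearity of the words of smooth functions -/

/-- `D_z(f − g) = D_zf − D_zg` for smooth `f, g`. [folklore] -/
theorem Dz_sub_smooth {f g : ℝ → ℝ → ℝ} (hf : Smooth2 f) (hg : Smooth2 g) : Dz (f - g) = Dz f - Dz g := by
  funext z θ
  simp only [Dz_apply, Pi.sub_apply]
  have h1 := hf.hasDerivAt_z z θ
  have h2 := hg.hasDerivAt_z z θ
  have h12 : HasDerivAt (fun z' => f z' θ - g z' θ) (dz f z θ - dz g z θ) z := h1.sub h2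
  rw [h12.deriv, h1.deriv, h2.deriv]
  ring

/-- `D_z^j(f − g) = D_z^jf − D_z^jg` for smooth `f, g`. [folklore] -/
theorem iterate_Dz_sub_smooth {f g : ℝ → ℝ → ℝ} (hf : Smooth2 f) (hg : Smooth2 g) (j : ℕ) : Dz^[j] (f - g) = Dz^[j] f - Dz^[j] g := by
  induction j generalizing f g with
  | zero => rfl
  | succ j ih => rw [Function.iterate_succ_apply, Function.iterate_succ_apply, Function.iterate_succ_apply, Dz_sub_smooth hf hg, ih hf.ofDz hg.ofDz]

/-! ### Differences of solution data -/

/-- The support of a difference. [folklore] -/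
theorem tsupport_sub_subset {f g : ℝ × ℝ → ℝ} : tsupport (f - g) ⊆ tsupport f ∪ tsupport g := by
  rw [sub_eq_add_neg]
  refine (tsupport_add _ _).trans (union_subset_union le_rfl ?_)
  rw [tsupport, tsupport, Function.support_neg]

/-- **Solution data subtract.** [folklore] -/
theorem SolData.sub {α : ℝ} {f₁ f₂ : ℝ → ℝ → ℝ} {U₁ U₂ : ℕ → E4} {Ψ₁ Ψ₂ : ℝ × ℝ → ℝ}
    (h₁ : SolData α f₁ U₁ Ψ₁) (h₂ : SolData α f₂ U₂ Ψ₂) : SolData α (f₁ - f₂) (U₁ - U₂) (Ψ₁ - Ψ₂) := by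
  have hf1 : ∀ n : ℕ, ContDiff ℝ n (uncurry (f₁ - f₂)) := fun n => by have := (h₁.fn n).sub (h₂.fn n); exact this
  have hfs : HasCompactSupport (uncurry (f₁ - f₂)) := by
    have : uncurry (f₁ - f₂) = uncurry f₁ - uncurry f₂ := by funext p; rfl
    rw [this, sub_eq_add_neg]; exact h₁.fs.add h₂.fs.neg
  have c1 : Continuous (uncurry f₁) := (h₁.fn 0).continuous
  have c2 : Continuous (uncurry f₂) := (h₂.fn 0).continuous
  refine ⟨h₁.pos, h₁.le4, hf1, hfs, fun p hp => ?_, fun n hn hns => ?_, fun j => ?_, h₁.smooth.sub h₂.smooth, ?_⟩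
  · -- positivity of the radius on the support
    have : uncurry (f₁ - f₂) = uncurry f₁ - uncurry f₂ := by funext p; rfl
    rw [this] at hp
    rcases tsupport_sub_subset hp with h | h
    · exact h₁.fpos p h
    · exact h₂.fpos p h
  · -- orthogonality
    have cK : Continuous kernelK := by unfold kernelK; fun_prop
    have cnK : Continuous fun p : ℝ × ℝ => n p.1 * kernelK p.2 := (hn.comp continuous_fst).mul (cK.comp continuous_snd)
    have i1 : Integrable fun p : ℝ × ℝ => f₁ p.1 p.2 * (n p.1 * kernelK p.2) := (c1.mul cnK).integrable_of_hasCompactSupport h₁.fs.mul_right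
    have i2 : Integrable fun p : ℝ × ℝ => f₂ p.1 p.2 * (n p.1 * kernelK p.2) := (c2.mul cnK).integrable_of_hasCompactSupport h₂.fs.mul_right
    have e : ∀ p : ℝ × ℝ, (f₁ - f₂) p.1 p.2 * (n p.1 * kernelK p.2) = f₁ p.1 p.2 * (n p.1 * kernelK p.2) - f₂ p.1 p.2 * (n p.1 * kernelK p.2) := by
      intro p; simp only [Pi.sub_apply]; ring
    simp_rw [e]
    rw [integral_sub i1.integrableOn i2.integrableOn, h₁.forth n hn hns, h₂.forth n hn hns, sub_zero]
  · -- weak solutions subtract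
    have hsm1 : Smooth2 f₁ := h₁.fn
    have hsm2 : Smooth2 f₂ := h₂.fn
    have m : ∀ {f : ℝ → ℝ → ℝ}, Smooth2 f → HasCompactSupport (uncurry f) → MemLp (fun p : ℝ × ℝ => (Dz^[j] f) p.1 p.2) 2 stripMeasure :=
      fun hf hs => memLp_strip_of_continuous ((hf.ofIterDz j) 0).continuous (hasCompactSupport_iterate_Dz hs j)
    have hsub := (h₁.sol j).sub (h₂.sol j)
    have e : toL2 (fun p : ℝ × ℝ => (Dz^[j] f₁) p.1 p.2) - toL2 (fun p : ℝ × ℝ => (Dz^[j] f₂) p.1 p.2) = toL2 (fun p : ℝ × ℝ => (Dz^[j] (f₁ - f₂)) p.1 p.2) := by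
      rw [← toL2_sub (m hsm1 h₁.fs) (m hsm2 h₂.fs)]
      congr 1
      funext p
      rw [iterate_Dz_sub_smooth hsm1 hsm2 j]; rfl
    rw [e] at hsub
    exact hsub
  · -- the representatives subtract a.e.
    have hL : ((U₁ 0 0 - U₂ 0 0 : L2Strip) : ℝ × ℝ → ℝ) =ᵐ[stripMeasure] (U₁ 0 0 : ℝ × ℝ → ℝ) - (U₂ 0 0 : ℝ × ℝ → ℝ) := Lp.coeFn_sub _ _
    have hL' : ∀ᵐ y ∂(volume : Measure (ℝ × ℝ)), y ∈ strip → ((U₁ 0 0 - U₂ 0 0 : L2Strip) : ℝ × ℝ → ℝ) y = (U₁ 0 0 : ℝ × ℝ → ℝ) y - (U₂ 0 0 : ℝ × ℝ → ℝ) y :=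
      (ae_restrict_iff' measurableSet_strip).1 hL
    filter_upwards [h₁.ae, h₂.ae, hL'] with y hy1 hy2 hyL
    intro hy
    show ((U₁ - U₂) 0 0 : ℝ × ℝ → ℝ) y = Ψ₁ y - Ψ₂ y
    rw [show (U₁ - U₂) 0 0 = U₁ 0 0 - U₂ 0 0 from rfl, hyL hy]
    show (U₁ 0 0 : ℝ × ℝ → ℝ) y - (U₂ 0 0 : ℝ × ℝ → ℝ) y = Ψ₁ y - Ψ₂ y
    rw [hy1 hy, hy2 hy]

/-! ### Differences of nice data and of the correctors -/

namespace NiceDatum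

variable {F₁ F₂ : ℝ → ℝ → ℝ} (h₁ : NiceDatum F₁) (h₂ : NiceDatum F₂)
include h₁ h₂

/-- Nice data subtract. [folklore] -/
theorem diff : NiceDatum (F₁ - F₂) := by
  have hs : HasCompactSupport (uncurry (F₁ - F₂)) := by
    have : uncurry (F₁ - F₂) = uncurry F₁ - uncurry F₂ := by funext p; rfl
    rw [this, sub_eq_add_neg]; exact h₁.supp.add h₂.supp.neg
  refine ⟨fun n => by have := (h₁.smooth n).sub (h₂.smooth n); exact this, hs, ?_⟩
  have : uncurry (F₁ - F₂) = uncurry F₁ - uncurry F₂ := by funext p; rfl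
  rw [this]
  exact tsupport_sub_subset.trans (union_subset h₁.sub h₂.sub)

/-- `kMoment` is linear on nice data. [folklore] -/
theorem kMoment_sub (R : ℝ) : kMoment (F₁ - F₂) R = kMoment F₁ R - kMoment F₂ R := by
  have c1 : Continuous (uncurry F₁) := (h₁.smooth 0).continuous
  have c2 : Continuous (uncurry F₂) := (h₂.smooth 0).continuous
  have e : F₁ - F₂ = fun R θ => F₁ R θ + (-1) * F₂ R θ := by funext R θ; simp; ring
  rw [e, kMoment_add c1 (by fun_prop), kMoment_const_mul]; ring

/-- `F̂` is linear on nice data. [folklore] -/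
theorem Fhat_sub : Fhat (F₁ - F₂) = Fhat F₁ - Fhat F₂ := by
  funext R θ
  simp only [Fhat, Pi.sub_apply, h₁.kMoment_sub h₂ R]
  ring

/-- `L₁₂` is linear on nice data. [folklore] -/
theorem L12_sub (z : ℝ) : L12 (F₁ - F₂) z = L12 F₁ z - L12 F₂ z := by
  rw [L12_eq_integral_kMoment_div, L12_eq_integral_kMoment_div, L12_eq_integral_kMoment_div]
  have hi : ∀ {F : ℝ → ℝ → ℝ}, NiceDatum F → Integrable fun r => kMoment F r / r := by
    intro F hF
    obtain ⟨a, b, ha, -, hrad⟩ := exists_radial_bounds' hF.supp hF.sub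
    have hc := continuous_kMoment_div (hF.smooth 0).continuous ha hrad
    refine hc.integrable_of_hasCompactSupport ?_
    refine HasCompactSupport.of_support_subset_isCompact (isCompact_Icc (a := a) (b := b)) fun r hr => ?_
    rw [mem_support] at hr
    by_contra h
    apply hr
    have h' : r < a ∨ b < r := by
      by_contra h''
      simp only [not_or, not_lt] at h''
      exact h ⟨h''.1, h''.2⟩
    rw [kMoment_eq_zero_of_not_mem hrad h', zero_div]
  have e : ∀ r, kMoment (F₁ - F₂) r / r = kMoment F₁ r / r - kMoment F₂ r / r := fun r => by
    rw [h₁.kMoment_sub h₂ r]; ring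
  simp_rw [e]
  exact integral_sub (hi h₁).integrableOn (hi h₂).integrableOn

/-- The radial average is linear (for integrable integrands). [folklore] -/
theorem radAvg_sub {p : ℝ} {g₁ g₂ : ℝ → ℝ} (hg₁ : Continuous g₁) (hg₂ : Continuous g₂) (R : ℝ) (hp : 1 ≤ p) :
    radAvg p (g₁ - g₂) R = radAvg p g₁ R - radAvg p g₂ R := by
  have := h₁; have := h₂
  unfold radAvg
  have hc : ∀ {g : ℝ → ℝ}, Continuous g → IntervalIntegrable (fun ρ => ρ ^ (p - 1) * g ρ) volume 0 R := fun hg =>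
    ((Continuous.rpow_const continuous_id fun _ => Or.inr (by linarith)).mul hg).intervalIntegrable _ _
  have e : ∀ ρ, ρ ^ (p - 1) * (g₁ - g₂) ρ = ρ ^ (p - 1) * g₁ ρ - ρ ^ (p - 1) * g₂ ρ := fun ρ => by simp only [Pi.sub_apply]; ring
  simp_rw [e]
  rw [intervalIntegral.integral_sub (hc hg₁) (hc hg₂)]; ring

/-- The corrector is linear on nice data (`0 < α ≤ 5`). [folklore] -/
theorem Gcor_sub {α : ℝ} (hα : 0 < α) (hα5 : α ≤ 5) (R : ℝ) : Gcor α (F₁ - F₂) R = Gcor α F₁ R - Gcor α F₂ R := by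
  have hp : (1:ℝ) ≤ 5 / α := by rw [le_div_iff₀ hα]; linarith
  have ek : kMoment (F₁ - F₂) = kMoment F₁ - kMoment F₂ := by funext r; rw [h₁.kMoment_sub h₂ r]; rfl
  simp only [Gcor, Gstar, Gbar, h₁.L12_sub h₂ R, ek,
    h₁.radAvg_sub h₂ (continuous_kMoment (h₁.smooth 0).continuous) (continuous_kMoment (h₂.smooth 0).continuous) R hp]
  ring

end NiceDatum

/-! ### Theorem 2 for differences -/

/-- The Theorem 2 solution is linear in `(F, Ψ̂)`. [folklore] -/
theorem thmTwoSol_sub {α : ℝ} (hα : 0 < α) (hα5 : α ≤ 5) {F₁ F₂ : ℝ → ℝ → ℝ} (h₁ : NiceDatum F₁) (h₂ : NiceDatum F₂) (Ψ₁ Ψ₂ : ℝ × ℝ → ℝ) :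
    thmTwoSol α (F₁ - F₂) (Ψ₁ - Ψ₂) = thmTwoSol α F₁ Ψ₁ - thmTwoSol α F₂ Ψ₂ := by
  funext R θ
  simp only [thmTwoSol, Pi.sub_apply, tensor_apply, h₁.Gcor_sub h₂ hα hα5 R]
  ring

/-- **Theorem 2 at `𝓗⁴` controls differences**: for nice data `F₁, F₂` and solution data of `F̂₁, F̂₂`,
the difference of the Theorem 2 solutions is the Theorem 2 solution of `F₁ − F₂`, hence obeys the bound
with `|F₁ − F₂|²_{𝓗⁴}`. [cite: Elgindi2021, §7.5 Theorem 2 (p. 24 of arXiv:1904.04795)] -/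
theorem theoremTwo_sub {α : ℝ} (hα : 0 < α) (hα4 : α ≤ 1 / 4) {F₁ F₂ : ℝ → ℝ → ℝ} (h₁ : NiceDatum F₁) (h₂ : NiceDatum F₂)
    {U₁ U₂ : ℕ → E4} {Ψ₁ Ψ₂ : ℝ × ℝ → ℝ} (hS₁ : SolData α (Fhat F₁) U₁ Ψ₁) (hS₂ : SolData α (Fhat F₂) U₂ Ψ₂) :
    (∀ p ∈ strip, ellipticOp α (thmTwoSol α F₁ Ψ₁ - thmTwoSol α F₂ Ψ₂) p.1 p.2 = (F₁ - F₂) p.1 p.2) ∧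
      eHkNormSq α 4 (dθ (dθ fun R θ => (thmTwoSol α F₁ Ψ₁ - thmTwoSol α F₂ Ψ₂) R θ - 1 / (4 * α) * L12 (F₁ - F₂) R * Real.sin (2 * θ))) +
        eHkNormSq α 4 ((α ^ 2) • (Dz^[2] (thmTwoSol α F₁ Ψ₁ - thmTwoSol α F₂ Ψ₂))) +
        eHkNormSq α 4 ((α ^ 2) • Dz (thmTwoSol α F₁ Ψ₁ - thmTwoSol α F₂ Ψ₂)) ≤ thmTwoC * eHkNormSq α 4 (F₁ - F₂) := by
  have hα5 : α ≤ 5 := hα4.trans (by norm_num)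
  have hSD : SolData α (Fhat (F₁ - F₂)) (U₁ - U₂) (Ψ₁ - Ψ₂) := by
    rw [h₁.Fhat_sub h₂]; exact hS₁.sub hS₂
  have h := theoremTwo_solData hα hα4 (h₁.diff h₂) hSD
  rw [thmTwoSol_sub hα hα5 h₁ h₂] at h
  exact ⟨h.2.1, h.2.2⟩

end Elgindi

end Literature.Analysis.FluidPDE
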